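import Summits.Ventures.YMGap.RobustBall.EnergyVarianceGibbsFloor
import Summits.Ventures.YMGap.RobustBall.EnergyVarianceTorusGeometry
import Summits.Ventures.YMGap.RobustBall.PlaquettePositivityOneLink
import Literature.MathematicalPhysics.QuantumLattice.TorusWilsonGibbs
import Literature.MathematicalPhysics.QuantumLattice.HeatKernelGroupMeasureProofs
import HarnessLib

/-!
# Robust ball (Y2), strong-coupling laws — an EXTENSIVE FLOOR for the energy variance of the torus Wilson state at every coupling

HONEST FRAMING: venture file of the cell `pub-ymgap` (QuantumFields programme), track ROBUST-BALL, seat rb-p2 (g8).  LATTICE statement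
about the finite-volume Wilson lattice gauge theory `μ_{Λ,β} ∝ e^{−β S_W} ∏ dU_e` on the torus `Λ = (ℤ/Lℤ)^d` (tree `wilsonMeasure`,
tree coupling `β`, `S_W = ∑_q (N − Re tr ρ(U_q))`) for a special unitary model `ρ` (`G ≅ SU(N)`, `N ≥ 2`): a LOWER bound on the
variance of the total energy, linear in the number of sites, at EVERY real `β`.  It is the input of the strong convexity of the free
energy density (`FreeEnergyStrongConvexity.lean`).  Nothing here is about the continuum, a spectral gap or the Clay problem.

THE THEOREM (`card_mul_le_variance_wilsonAction`).  `L ≥ 2`, `i < j` two directions, `S` a set of sites no two of which differ by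
a unit step in a direction `≠ i`.  Then

  `|S| · e^{−8(d−1)N|β|} · V₀ ≤ Var_{μ_{Λ,β}}(S_W) = ∫ (S_W − ⟨S_W⟩)² dμ_{Λ,β}`,   `V₀ = ∫ (Re tr ρ)² dHaar = charVariance ρ`.

MECHANISM (elementary; no expansion, no reflection positivity): the torus Wilson state is the Gibbs law of the bounded energy
`β S_W` on the finite product `(G^{links}, Haar^{⊗})` (`wilsonMeasure_eq_gibbsMeasure`), so the inverse Efron–Stein inequality of
`EnergyVarianceGibbsFloor` applies with the direction-`i` links `F = {(x, i) : x ∈ S}`: they are pairwise on no common plaquette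
(`EnergyVarianceTorusGeometry.pairwise_separated_of_sparse`), `S_W` (hence `β S_W`) is additively separable across them and has one-link
oscillation `≤ D = 4(d−1)N|β|`.  This gives `Var(S_W) ≥ e^{−D} ∑_{f ∈ F} E_μ[Var_Haar(h ↦ S_W(U^{f←h}))]`.  The mean Haar fibre variance at
`f = (x, i)` is bounded below by resampling the PRIVATE link `f' = (x, j)` of the base plaquette `(x; i<j)` from Haar measure (cost
`e^{−D}`, `exp_neg_mul_integral_resample_le`): after the resampling the base plaquette contributes `Re tr ρ(h a h'⁻¹)` with `h'`
Haar-distributed, whose Haar variance in `h'` is the full character variance `V₀` whatever the other plaquettes through `f` do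
(`charVariance_le_integral_fibreVariance`, from rb-p2 g3's `integral_add_reTr_sq`).

References: E. Seiler, LNP 159 (1982), Ch. 2; H.-O. Georgii, *Gibbs Measures and Phase Transitions* (2011), Remark 1.24.
Everything here is proved; no definition, no named fact. [folklore]
-/

noncomputable section

open MeasureTheory ProbabilityTheory Finset Function
open Literature.MathematicalPhysics.QuantumFieldTheory.Balaban1983to89.T4DobrushinTensorisation
open Literature.MathematicalPhysics.QuantumFieldTheory.Balaban1983to89.T4CouplingChain (integrable_of_abs_le_const)
open Literature.MathematicalPhysics.QuantumLattice Literature.MathematicalPhysics.QuantumFieldTheory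

namespace Summit.Ventures.YMGap.RobustBall

namespace EnergyVariance

variable {d L N : ℕ} [NeZero L] {G : Type*} [Group G] [TopologicalSpace G] [IsTopologicalGroup G]
  [CompactSpace G] [MeasurableSpace G] [BorelSpace G] [SecondCountableTopology G]
  (ρ : G →* Matrix (Fin N) (Fin N) ℂ)

/-! ### The torus Wilson state is the Gibbs law of the energy `β S_W` on the product of Haar measures -/

/-- `μ_{Λ,β} = gibbsMeasure (Haar^{⊗ links}) (β S_W)` (the tree's `wilsonMeasure_eq_tilted_pi`, rewritten on the `gibbsMeasure`
interface of `T4DobrushinTensorisation`). [folklore] -/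
theorem wilsonMeasure_eq_gibbsMeasure (hρ : Continuous ρ) (β : ℝ) :
    wilsonMeasure (d := d) (L := L) ρ β =
      gibbsMeasure (fun _ : Edge d L => haarProbability G) (fun U : GaugeConfig d L G => β * wilsonAction ρ U) := by
  rw [wilsonMeasure_eq_tilted_pi ρ hρ β, gibbsMeasure]
  unfold Measure.tilted gibbsWeight totalZ
  congr 1
  funext U
  simp only [neg_mul]

/-- The energy `β S_W` is measurable and bounded, with one-link oscillation `≤ 4(d−1)N|β|` for unitary `ρ`. [folklore] -/
theorem energy_measurable_bounded_osc (hρ : Continuous ρ) (hρu : ∀ g, ρ g ∈ Matrix.unitaryGroup (Fin N) ℂ) (β : ℝ) :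
    Measurable (fun U : GaugeConfig d L G => β * wilsonAction ρ U) ∧
      (∃ a : ℝ, ∀ U : GaugeConfig d L G, |β * wilsonAction ρ U| ≤ a) ∧
      ∀ (e : Edge d L) (U : GaugeConfig d L G) (y z : G),
        β * wilsonAction ρ (update U e y) - β * wilsonAction ρ (update U e z) ≤ 4 * (d - 1 : ℕ) * N * |β| := by
  obtain ⟨B, hB⟩ := exists_abs_wilsonAction_le (d := d) (L := L) ρ hρ
  refine ⟨(measurable_wilsonAction ρ hρ).const_mul β, ⟨|β| * B, fun U => ?_⟩, fun e U y z => ?_⟩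
  · rw [abs_mul]; exact mul_le_mul_of_nonneg_left (hB U) (abs_nonneg β)
  · rw [← mul_sub]
    calc β * (wilsonAction ρ (update U e y) - wilsonAction ρ (update U e z))
        ≤ |β * (wilsonAction ρ (update U e y) - wilsonAction ρ (update U e z))| := le_abs_self _
      _ = |β| * |wilsonAction ρ (update U e y) - wilsonAction ρ (update U e z)| := abs_mul _ _
      _ ≤ |β| * (4 * (d - 1 : ℕ) * N) :=
          mul_le_mul_of_nonneg_left (abs_wilsonAction_update_sub_le ρ hρu e U y z) (abs_nonneg β)
      _ = 4 * (d - 1 : ℕ) * N * |β| := by ring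

/-! ### The Haar fibre variance of the energy at one link -/

omit [CompactSpace G] in
/-- Joint measurability of `(U, h) ↦ S_W(U^{e←h})`. [folklore] -/
theorem measurable_wilsonAction_update (hρ : Continuous ρ) (e : Edge d L) :
    Measurable fun p : GaugeConfig d L G × G => wilsonAction ρ (update p.1 e p.2) :=
  (measurable_wilsonAction ρ hρ).comp measurable_update'

/-- The Haar fibre variance `U ↦ ∫ (S_W(U^{e←h}) − ∫ S_W(U^{e←z}) dz)² dh` is measurable, non-negative and bounded. [folklore] -/
theorem measurable_fibreVariance_wilsonAction (hρ : Continuous ρ) (e : Edge d L) :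
    Measurable (fun U : GaugeConfig d L G =>
        ∫ h, (wilsonAction ρ (update U e h) - ∫ z, wilsonAction ρ (update U e z) ∂haarProbability G) ^ 2 ∂haarProbability G) ∧
      (∀ U : GaugeConfig d L G,
        0 ≤ ∫ h, (wilsonAction ρ (update U e h) - ∫ z, wilsonAction ρ (update U e z) ∂haarProbability G) ^ 2 ∂haarProbability G) ∧
      ∃ C : ℝ, ∀ U : GaugeConfig d L G,
        |∫ h, (wilsonAction ρ (update U e h) - ∫ z, wilsonAction ρ (update U e z) ∂haarProbability G) ^ 2 ∂haarProbability G| ≤ C := by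
  obtain ⟨B, hB⟩ := exists_abs_wilsonAction_le (d := d) (L := L) ρ hρ
  have hj := measurable_wilsonAction_update ρ hρ e
  have hM : Measurable fun U : GaugeConfig d L G => ∫ z, wilsonAction ρ (update U e z) ∂haarProbability G :=
    (hj.stronglyMeasurable.integral_prod_right' (ν := haarProbability G)).measurable
  have hsq : Measurable fun p : GaugeConfig d L G × G =>
      (wilsonAction ρ (update p.1 e p.2) - ∫ z, wilsonAction ρ (update p.1 e z) ∂haarProbability G) ^ 2 :=
    (hj.sub (hM.comp measurable_fst)).pow_const 2
  refine ⟨(hsq.stronglyMeasurable.integral_prod_right' (ν := haarProbability G)).measurable,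
    fun U => integral_nonneg fun h => sq_nonneg _, ⟨(B + B) ^ 2, fun U => ?_⟩⟩
  have hMb : |∫ z, wilsonAction ρ (update U e z) ∂haarProbability G| ≤ B := abs_integral_le_of_abs_le _ fun z => hB _
  exact abs_integral_le_of_abs_le _ fun h => by
    rw [abs_pow]
    exact pow_le_pow_left₀ (abs_nonneg _) ((abs_sub _ _).trans (add_le_add (hB _) hMb)) 2

/-- ★ **Resampling the private link restores the character variance.**  `L ≥ 2`, `i < j`, `G ≅ SU(N)`, `N ≥ 2`: for every
configuration `U`, averaging over the link `(x, j)` resampled from Haar measure, the Haar fibre variance of `S_W` at the link `(x, i)`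
is at least `V₀ = charVariance ρ`:
`V₀ ≤ ∫ Var_{Haar}(h ↦ S_W(U^{(x,j)←h', (x,i)←h})) dh'`. [folklore] -/
theorem charVariance_le_integral_fibreVariance (hρ : IsSpecialUnitaryModel ρ) (hN : 2 ≤ N) (hL : 1 < L)
    {x : Site d L} {i j : Fin d} (hij : i < j) (U : GaugeConfig d L G) :
    PlaquetteLowerBound.charVariance ρ ≤
      ∫ h', (∫ h, (wilsonAction ρ (update (update U (x, j) h') (x, i) h) -
          ∫ z, wilsonAction ρ (update (update U (x, j) h') (x, i) z) ∂haarProbability G) ^ 2 ∂haarProbability G)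
        ∂haarProbability G := by
  classical
  have hρc : Continuous ρ := hρ.1
  have hρu := IsSpecialUnitaryModel.mem_unitaryGroup ρ hρ
  set f : Edge d L := (x, i) with hf
  set f' : Edge d L := (x, j) with hf'
  set p₀ : Plaquette d L := (x, ⟨(i, j), hij⟩) with hp₀def
  set a : G := U (x.shift i, j) * (U (x.shift j, i))⁻¹ with ha
  have hne : f' ≠ f := fun h => (ne_of_lt hij) (congrArg Prod.snd h).symm
  have hp₀ : p₀ ∈ plaqsThrough f := mem_plaqsThrough.2 (mem_plaqEdgesT_base x hij).1
  -- the plaquette costs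
  set cost : Plaquette d L → GaugeConfig d L G → ℝ := fun q V =>
    (N : ℝ) - (ρ (plaquetteHolonomy V q.1 q.2.1.1 q.2.1.2)).trace.re with hcost
  set R : G → ℝ := fun h => ∑ q ∈ (plaqsThrough f).erase p₀, cost q (update U f h) with hR
  set C : G → ℝ := fun h' => ∑ q ∈ (plaqsThrough f)ᶜ, cost q (update U f' h') with hC
  -- the decomposition `S_W(U^{f'←h', f←h}) = (N − Re tr ρ(h a h'⁻¹)) + R h + C h'`
  have hdecomp : ∀ h h', wilsonAction ρ (update (update U f' h') f h) =
      ((N : ℝ) - (ρ (h * a * h'⁻¹)).trace.re) + R h + C h' := by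
    intro h h'
    have hS : wilsonAction ρ (update (update U f' h') f h) = ∑ q, cost q (update (update U f' h') f h) := rfl
    rw [hS, ← Finset.sum_add_sum_compl (plaqsThrough f), ← Finset.add_sum_erase _ _ hp₀]
    have h1 : cost p₀ (update (update U f' h') f h) = (N : ℝ) - (ρ (h * a * h'⁻¹)).trace.re := by
      have : plaquetteHolonomy (update (update U f' h') f h) p₀.1 p₀.2.1.1 p₀.2.1.2 =
          plaquetteHolonomy (update (update U (x, j) h') (x, i) h) x i j := rfl
      simp only [hcost]
      rw [this, plaquetteHolonomy_base_update_update hL (ne_of_lt hij) U h h', ha, mul_assoc]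
    have h2 : ∀ q ∈ (plaqsThrough f).erase p₀, cost q (update (update U f' h') f h) = cost q (update U f h) := by
      intro q hq
      obtain ⟨hqp, hqf⟩ := Finset.mem_erase.1 hq
      rw [mem_plaqsThrough] at hqf
      have hf'q : f' ∉ plaqEdgesT q := fun h' => hqp (eq_basePlaquette_of_mem_of_mem hL hij hqf h')
      simp only [hcost]
      rw [update_comm hne, plaquetteHolonomy_update_of_not_mem hf'q]
    have h3 : ∀ q ∈ (plaqsThrough f)ᶜ, cost q (update (update U f' h') f h) = cost q (update U f' h') := by
      intro q hq
      rw [Finset.mem_compl, mem_plaqsThrough] at hq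
      simp only [hcost]
      rw [plaquetteHolonomy_update_of_not_mem hq]
    rw [h1, Finset.sum_congr rfl h2, Finset.sum_congr rfl h3]
  -- continuity of the pieces
  have hcostc : ∀ (q : Plaquette d L) (e : Edge d L), Continuous fun h : G => cost q (update U e h) := fun q e =>
    continuous_const.sub ((continuous_trace_re ρ hρc).comp
      ((continuous_plaquetteHolonomy _ _ _).comp (continuous_const.update e continuous_id)))
  have hRc : Continuous R := by
    simp only [hR]
    exact continuous_finsetSum _ fun q _ => hcostc q f
  set Rbar : ℝ := ∫ h, R h ∂haarProbability G with hRbar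
  -- the fibre mean: `∫ S_W(U^{f'←h', f←z}) dz = N + Rbar + C h'`
  have hmean : ∀ h', ∫ z, wilsonAction ρ (update (update U f' h') f z) ∂haarProbability G = (N : ℝ) + Rbar + C h' := by
    intro h'
    simp_rw [hdecomp]
    have hiX : Integrable (fun z : G => (ρ (z * a * h'⁻¹)).trace.re) (haarProbability G) :=
      ((continuous_trace_re ρ hρc).comp ((continuous_id.mul continuous_const).mul continuous_const)).integrable_of_hasCompactSupport
        (HasCompactSupport.of_compactSpace _)
    have hi1 : Integrable (fun z : G => (N : ℝ) - (ρ (z * a * h'⁻¹)).trace.re) (haarProbability G) := (integrable_const _).sub hiX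
    have hi2 : Integrable R (haarProbability G) := hRc.integrable_of_hasCompactSupport (HasCompactSupport.of_compactSpace _)
    have hi12 : Integrable (fun z : G => (N : ℝ) - (ρ (z * a * h'⁻¹)).trace.re + R z) (haarProbability G) := hi1.add hi2
    have h0 : ∫ z : G, (ρ (z * a * h'⁻¹)).trace.re ∂haarProbability G = 0 := by
      have := PlaquettePositivity.integral_reTr_mul_mul_eq_zero ρ hρ hN 1 (a * h'⁻¹)
      simp_rw [one_mul, ← mul_assoc] at this
      exact this
    rw [integral_add hi12 (integrable_const _), integral_add hi1 hi2, integral_sub (integrable_const _) hiX, integral_const,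
      integral_const, h0, hRbar]
    simp only [smul_eq_mul, probReal_univ, one_mul, sub_zero]
  -- rewrite the integrand
  have hpt : ∀ h h', (wilsonAction ρ (update (update U f' h') f h) -
      ∫ z, wilsonAction ρ (update (update U f' h') f z) ∂haarProbability G) ^ 2 =
      (-(R h - Rbar) + (ρ ((a⁻¹ * h⁻¹)⁻¹ * h'⁻¹)).trace.re) ^ 2 := by
    intro h h'
    rw [hmean h', hdecomp h h', mul_inv_rev, inv_inv, inv_inv]
    ring
  simp_rw [hpt]
  -- `Re tr ρ(h a h'⁻¹) = Re tr ρ(h' a⁻¹ h⁻¹)` (unitarity), then Fubini and the character-variance identity in `h'`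
  have hinv : ∀ h h' : G, (ρ ((a⁻¹ * h⁻¹)⁻¹ * h'⁻¹)).trace.re = (ρ (1 * h' * (a⁻¹ * h⁻¹))).trace.re := by
    intro h h'
    have hg : (a⁻¹ * h⁻¹)⁻¹ * h'⁻¹ = (h' * (a⁻¹ * h⁻¹))⁻¹ := by group
    rw [one_mul, ← re_trace_map_inv ρ hρu (h' * (a⁻¹ * h⁻¹)), ← hg]
  simp_rw [hinv]
  have hFc : Continuous fun p : G × G => (-(R p.2 - Rbar) + (ρ (1 * p.1 * (a⁻¹ * p.2⁻¹))).trace.re) ^ 2 :=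
    (((hRc.comp continuous_snd).sub continuous_const).neg.add ((continuous_trace_re ρ hρc).comp
      ((continuous_const.mul continuous_fst).mul (continuous_const.mul continuous_snd.inv)))).pow 2
  have hFi : Integrable (uncurry fun h' h : G => (-(R h - Rbar) + (ρ (1 * h' * (a⁻¹ * h⁻¹))).trace.re) ^ 2)
      ((haarProbability G).prod (haarProbability G)) :=
    hFc.integrable_of_hasCompactSupport (HasCompactSupport.of_compactSpace _)
  rw [integral_integral_swap hFi]
  have hinner : ∀ h : G, ∫ h', (-(R h - Rbar) + (ρ (1 * h' * (a⁻¹ * h⁻¹))).trace.re) ^ 2 ∂haarProbability G =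
      (-(R h - Rbar)) ^ 2 + PlaquetteLowerBound.charVariance ρ := fun h =>
    PlaquettePositivity.integral_add_reTr_sq ρ hρ hN _ 1 (a⁻¹ * h⁻¹)
  simp_rw [hinner]
  have hi : Integrable (fun h : G => (-(R h - Rbar)) ^ 2) (haarProbability G) :=
    ((hRc.sub continuous_const).neg.pow 2).integrable_of_hasCompactSupport (HasCompactSupport.of_compactSpace _)
  rw [integral_add hi (integrable_const _), integral_const, smul_eq_mul, probReal_univ, one_mul]
  have hnn : 0 ≤ ∫ h : G, (-(R h - Rbar)) ^ 2 ∂haarProbability G := integral_nonneg fun h => sq_nonneg _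
  linarith

/-! ### The extensive energy-variance floor -/

/-- ★★ **EXTENSIVE FLOOR FOR THE ENERGY VARIANCE OF THE TORUS WILSON STATE, at every coupling.**  `G ≅ SU(N)` (`N ≥ 2`), torus of
side `L ≥ 2`, `i < j` two directions, `S` a set of sites no two of which differ by a unit step in a direction `≠ i`.  Then for every
real `β`

  `|S| · e^{−8(d−1)N|β|} · V₀ ≤ ∫ (S_W − ∫ S_W dμ_{Λ,β})² dμ_{Λ,β}`,   `V₀ = charVariance ρ = ∫ (Re tr ρ)² dHaar`.

(Inverse Efron–Stein over the direction-`i` links based in `S`, one-link density floor `e^{−4(d−1)N|β|}` twice, private-link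
resampling.) [folklore] -/
theorem card_mul_le_variance_wilsonAction (hρ : IsSpecialUnitaryModel ρ) (hN : 2 ≤ N) (hL : 1 < L) {i j : Fin d} (hij : i < j)
    (S : Finset (Site d L)) (hS : ∀ x ∈ S, ∀ x' ∈ S, ∀ k : Fin d, k ≠ i → x' ≠ x.shift k) (β : ℝ) :
    (S.card : ℝ) * Real.exp (-(8 * (d - 1 : ℕ) * N * |β|)) * PlaquetteLowerBound.charVariance ρ ≤
      ∫ U, (wilsonAction ρ U - ∫ V, wilsonAction ρ V ∂wilsonMeasure (d := d) (L := L) ρ β) ^ 2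
        ∂wilsonMeasure (d := d) (L := L) ρ β := by
  classical
  have hρc : Continuous ρ := hρ.1
  have hρu := IsSpecialUnitaryModel.mem_unitaryGroup ρ hρ
  set π : Edge d L → Measure G := fun _ => haarProbability G with hπ
  set A : GaugeConfig d L G → ℝ := fun U => β * wilsonAction ρ U with hA
  obtain ⟨hAm, ⟨a, hAb⟩, hosc⟩ := energy_measurable_bounded_osc (d := d) (L := L) ρ hρc hρu β
  set D : ℝ := 4 * (d - 1 : ℕ) * N * |β| with hD
  haveI : ∀ e, IsMarkovKernel (gibbsKernel π A e) := fun e => isMarkovKernel_gibbsKernel hAm hAb e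
  haveI hQ : IsProbabilityMeasure (gibbsMeasure π A) := isProbabilityMeasure_gibbsMeasure (π := π) hAm hAb
  have hinv : ResamplingInvariant (gibbsMeasure π A) (gibbsKernel π A) := resamplingInvariant_gibbs (π := π) hAm hAb
  rw [wilsonMeasure_eq_gibbsMeasure ρ hρc β]
  change (S.card : ℝ) * Real.exp (-(8 * (d - 1 : ℕ) * N * |β|)) * PlaquetteLowerBound.charVariance ρ ≤
    ∫ U, (wilsonAction ρ U - ∫ V, wilsonAction ρ V ∂gibbsMeasure π A) ^ 2 ∂gibbsMeasure π A
  obtain ⟨B, hB⟩ := exists_abs_wilsonAction_le (d := d) (L := L) ρ hρc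
  -- the link set
  set F : Finset (Edge d L) := S.image fun x => (x, i) with hF
  have hFcard : F.card = S.card := Finset.card_image_of_injective _ fun x x' h => (Prod.mk.inj h).1
  have hsep : ∀ e ∈ F, ∀ e' ∈ F, e ≠ e' → ∀ q : Plaquette d L, e ∈ plaqEdgesT q → e' ∉ plaqEdgesT q := by
    intro e he e' he' hee' q hq
    obtain ⟨x, hx, rfl⟩ := Finset.mem_image.1 he
    obtain ⟨x', hx', rfl⟩ := Finset.mem_image.1 he'
    have hxx' : x ≠ x' := fun h => hee' (by rw [h])
    exact pairwise_separated_of_sparse hS hx hx' hxx' q hq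
  -- Step 1: inverse Efron–Stein for the Gibbs law
  have h1 := sum_fibreVariance_le_variance_gibbs (π := π) hAm hAb (measurable_wilsonAction ρ hρc) hB F (δ := D)
    (fun e _ U y z => hosc e U y z)
    (fun e he e' he' hne U y z => by
      show β * _ - β * _ = β * _ - β * _
      rw [← mul_sub, ← mul_sub, wilsonAction_update_update_sub ρ (hsep e he e' he' hne) U y z])
    (fun e he e' he' hne U y z => wilsonAction_update_update_sub ρ (hsep e he e' he' hne) U y z)
  -- Step 2: each mean fibre variance is at least `e^{−D} V₀` (resample the private link)
  have h2 : ∀ e ∈ F, Real.exp (-D) * PlaquetteLowerBound.charVariance ρ ≤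
      ∫ U, (∫ h, (wilsonAction ρ (update U e h) - ∫ z, wilsonAction ρ (update U e z) ∂π e) ^ 2 ∂π e) ∂gibbsMeasure π A := by
    intro e he
    obtain ⟨x, hx, rfl⟩ := Finset.mem_image.1 he
    obtain ⟨hgm, hg0, C, hgC⟩ := measurable_fibreVariance_wilsonAction (d := d) (L := L) ρ hρc (x, i)
    have hres := exp_neg_mul_integral_resample_le (π := π) hAm hAb hinv (x, j) (δ := D) (fun U y z => hosc (x, j) U y z)
      hgm hgC hg0
    refine le_trans ?_ hres
    refine mul_le_mul_of_nonneg_left ?_ (Real.exp_pos _).le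
    -- pointwise the inner Haar average is `≥ V₀`
    have hpt : ∀ U : GaugeConfig d L G, PlaquetteLowerBound.charVariance ρ ≤
        ∫ y, (∫ h, (wilsonAction ρ (update (update U (x, j) y) (x, i) h) -
          ∫ z, wilsonAction ρ (update (update U (x, j) y) (x, i) z) ∂π (x, i)) ^ 2 ∂π (x, i)) ∂π (x, j) :=
      fun U => charVariance_le_integral_fibreVariance ρ hρ hN hL hij U
    calc PlaquetteLowerBound.charVariance ρ = ∫ _U, PlaquetteLowerBound.charVariance ρ ∂gibbsMeasure π A := by
          rw [integral_const, smul_eq_mul, probReal_univ, one_mul]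
      _ ≤ _ := by
          refine integral_mono_of_nonneg (Filter.Eventually.of_forall fun U => ?_) ?_
            (Filter.Eventually.of_forall hpt)
          · exact (PlaquetteLowerBound.charVariance_pos ρ hρc (by omega)).le
          · have hm : Measurable fun U : GaugeConfig d L G => ∫ y, (∫ h, (wilsonAction ρ (update (update U (x, j) y) (x, i) h) -
                ∫ z, wilsonAction ρ (update (update U (x, j) y) (x, i) z) ∂π (x, i)) ^ 2 ∂π (x, i)) ∂π (x, j) :=
              ((hgm.comp measurable_update').stronglyMeasurable.integral_prod_right' (ν := π (x, j))).measurable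
            exact integrable_of_abs_le_const hm.stronglyMeasurable fun U => abs_integral_le_of_abs_le _ fun y => hgC _
  -- Step 3: assemble
  have h3 : ∑ e ∈ F, Real.exp (-D) * PlaquetteLowerBound.charVariance ρ ≤
      ∑ e ∈ F, ∫ U, (∫ h, (wilsonAction ρ (update U e h) - ∫ z, wilsonAction ρ (update U e z) ∂π e) ^ 2 ∂π e)
        ∂gibbsMeasure π A := Finset.sum_le_sum h2
  rw [Finset.sum_const, nsmul_eq_mul, hFcard] at h3
  have hexp : Real.exp (-(8 * (d - 1 : ℕ) * N * |β|)) = Real.exp (-D) * Real.exp (-D) := by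
    rw [← Real.exp_add, hD]; ring_nf
  calc (S.card : ℝ) * Real.exp (-(8 * (d - 1 : ℕ) * N * |β|)) * PlaquetteLowerBound.charVariance ρ
      = Real.exp (-D) * ((S.card : ℝ) * (Real.exp (-D) * PlaquetteLowerBound.charVariance ρ)) := by rw [hexp]; ring
    _ ≤ Real.exp (-D) * ∑ e ∈ F, ∫ U, (∫ h, (wilsonAction ρ (update U e h) -
          ∫ z, wilsonAction ρ (update U e z) ∂π e) ^ 2 ∂π e) ∂gibbsMeasure π A :=
        mul_le_mul_of_nonneg_left h3 (Real.exp_pos _).le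
    _ ≤ _ := h1

/-- The same floor for the Mathlib variance `Var[S_W; μ_{Λ,β}]`. [folklore] -/
theorem card_mul_le_variance_wilsonAction' (hρ : IsSpecialUnitaryModel ρ) (hN : 2 ≤ N) (hL : 1 < L) {i j : Fin d}
    (hij : i < j) (S : Finset (Site d L)) (hS : ∀ x ∈ S, ∀ x' ∈ S, ∀ k : Fin d, k ≠ i → x' ≠ x.shift k) (β : ℝ) :
    (S.card : ℝ) * Real.exp (-(8 * (d - 1 : ℕ) * N * |β|)) * PlaquetteLowerBound.charVariance ρ ≤
      Var[wilsonAction (d := d) (L := L) (G := G) ρ; wilsonMeasure (d := d) (L := L) ρ β] := by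
  rw [variance_eq_integral (measurable_wilsonAction ρ hρ.1).aemeasurable]
  exact card_mul_le_variance_wilsonAction ρ hρ hN hL hij S hS β

end EnergyVariance

end Summit.Ventures.YMGap.RobustBall
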